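import Summits.KontsevichZagierPeriods.Zeta5Search.WedgeDictionaryCornerIdentity
import Summits.KontsevichZagierPeriods.Zeta5Search.SymmetricFamilyInnerSum
import HarnessLib

/-!
# The corner `ζ(5)`-coefficients are Cooper's sporadic Apéry-like numbers `s₇`: `cornerU_level7` PROVED (cell `pub-zeta5`, P1)

HONEST FRAMING: systematic search; no irrationality claim unless certified.

OUR work (Summit side), P1 seat generation 2. Cooper's level-7 sequence
`s₇(n) = Σ_k C(n,k)² C(n+k,n) C(2k,n) = 1, 4, 48, 760, 13840, …` (`cooperS7` of `WedgeDictionaryCorner.lean`;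
S. Cooper, arXiv:1210.2493, p. 2) satisfies `(n+1)³s₇(n+1) = (2n+1)(13n²+13n+4)s₇(n) + 3n(9n²−1)s₇(n−1)`
(`cooperS7_rec`, PROVED here for all `n` by an explicit creative-telescoping certificate found by the cell,
`HOME/code/p1/corner/s7_cert.py`: with `F(n,k)` the summand and `a = (−3(n+1)(9(n+1)²−1), −(2n+3)(13(n+1)²+13(n+1)+4), (n+2)³)`,
`Σ_i a_i F(n+i,k) = G(n,k+1) − G(n,k)`,
`G(n,k) = k²[(15n+22)k² − 13(n+2)(2n+3)k + (n+2)²(7n+11)]·C(n+2,k)²C(n+k,n)C(2k,n+2)/((n+1)(n+2))`).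
Since the gauged corner coefficients `(−1)^n n!⁶ U(n;0⁷)` solve the same recurrence (`cornerU_recurrence`,
`WedgeDictionaryCornerIdentity.lean`) with the same two initial values, `cornerU_level7_holds : cornerU_level7`:
`n!⁶ · U(n;0⁷) = 2(−1)^n s₇(n)` for every `n` — the conjecture of gen-1 g3 is a THEOREM.
-/

noncomputable section

open Finset

namespace Summit.KontsevichZagierPeriods.Zeta5Search.WedgeDictionary

open Summit.KontsevichZagierPeriods.Zeta5Search.SymmetricRecursion (choose_succ_left_cast choose_succ_right_cast
  choose_add_succ_left_cast choose_add_succ_right_cast)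

/-! ### The summand, the certificate and the termwise identity -/

/-- `C(m+1,j+1)·(j+1) = C(m,j)·(m+1)` in `ℚ`, for all `m, j`. -/
theorem choose_succ_succ_cast (m j : ℕ) :
    (((m + 1).choose (j + 1) : ℕ) : ℚ) * ((j : ℚ) + 1) = ((m.choose j : ℕ) : ℚ) * ((m : ℚ) + 1) := by
  have e := Nat.add_one_mul_choose_eq m j
  have e' : ((m : ℚ) + 1) * ((m.choose j : ℕ) : ℚ) = (((m + 1).choose (j + 1) : ℕ) : ℚ) * ((j : ℚ) + 1) := by
    exact_mod_cast e
  linarith [e']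

/-- The summand `F(n,k) = C(n,k)² C(n+k,n) C(2k,n)` of `s₇(n)` as a rational (zero unless `n ≤ 2k`, `k ≤ n`). -/
def s7Term (n k : ℕ) : ℚ :=
  ((n.choose k : ℕ) : ℚ) ^ 2 * (((n + k).choose n : ℕ) : ℚ) * (((2 * k).choose n : ℕ) : ℚ)

/-- `s₇(n) = Σ_{k ≤ n} F(n,k)` in `ℚ`. -/
theorem cast_cooperS7 (n : ℕ) : ((cooperS7 n : ℕ) : ℚ) = ∑ k ∈ range (n + 1), s7Term n k := by
  simp [cooperS7, s7Term, Nat.cast_sum, Nat.cast_mul, Nat.cast_pow]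

/-- The certificate `G(n,k)` (division-free up to the constant `(n+1)(n+2)`). -/
def s7Cert (n k : ℕ) : ℚ :=
  (k : ℚ) ^ 2 * ((15 * (n : ℚ) + 22) * (k : ℚ) ^ 2 - 13 * ((n : ℚ) + 2) * (2 * n + 3) * k + ((n : ℚ) + 2) ^ 2 * (7 * n + 11))
    * (((n + 2).choose k : ℕ) : ℚ) ^ 2 * (((n + k).choose n : ℕ) : ℚ) * (((2 * k).choose (n + 2) : ℕ) : ℚ)
    / (((n : ℚ) + 1) * ((n : ℚ) + 2))

/-- The telescoper is the level-7 operator at index `n+1`: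
`−3(n+1)(9(n+1)²−1)F(n,k) − (2n+3)(13(n+1)²+13(n+1)+4)F(n+1,k) + (n+2)³F(n+2,k) = G(n,k+1) − G(n,k)`. -/
theorem s7_termwise (n k : ℕ) :
    -3 * ((n : ℚ) + 1) * (9 * ((n : ℚ) + 1) ^ 2 - 1) * s7Term n k
      - (2 * (n : ℚ) + 3) * (13 * ((n : ℚ) + 1) ^ 2 + 13 * ((n : ℚ) + 1) + 4) * s7Term (n + 1) k
      + ((n : ℚ) + 2) ^ 3 * s7Term (n + 2) k = s7Cert n (k + 1) - s7Cert n k := by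
  -- express every binomial through A = C(n+2,k), B = C(n+k,n), D = C(2k,n)
  have hn1 : ((n : ℚ) + 1) ≠ 0 := by positivity
  have hn2 : ((n : ℚ) + 2) ≠ 0 := by positivity
  have hk1 : ((k : ℚ) + 1) ≠ 0 := by positivity
  have hA1 := choose_succ_left_cast (n + 1) k
  have hA0 := choose_succ_left_cast n k
  have hA3 := choose_succ_right_cast (n + 2) k
  have hB1 := choose_add_succ_left_cast n k
  have hB2 := choose_add_succ_left_cast (n + 1) k
  have hB3 := choose_add_succ_right_cast n k
  have hD1 := choose_succ_right_cast (2 * k) n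
  have hD2 := choose_succ_right_cast (2 * k) (n + 1)
  have hE1 := choose_succ_succ_cast (2 * k) n
  have hE2 := choose_succ_succ_cast (2 * k + 1) (n + 1)
  rw [show n + 1 + 1 = n + 2 from rfl] at hA1 hD2 hE2
  rw [show n + 2 + k = n + 2 + k from rfl] at hB2
  rw [show n + 1 + 1 + k = n + 2 + k from rfl, show n + 1 + 1 = n + 2 from rfl] at hB2
  rw [show 2 * k + 1 + 1 = 2 * (k + 1) by ring] at hE2
  push_cast at hA1 hA0 hA3 hB1 hB2 hB3 hD1 hD2 hE1 hE2
  have a1 : (((n + 1).choose k : ℕ) : ℚ) = (((n + 2).choose k : ℕ) : ℚ) * (((n : ℚ) + 2 - k) / ((n : ℚ) + 2)) := by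
    rw [mul_div_assoc', eq_div_iff hn2]; linear_combination (-1 : ℚ) * hA1
  have a0 : ((n.choose k : ℕ) : ℚ) = (((n + 2).choose k : ℕ) : ℚ) *
      ((((n : ℚ) + 1 - k) * ((n : ℚ) + 2 - k)) / (((n : ℚ) + 1) * ((n : ℚ) + 2))) := by
    rw [mul_div_assoc', eq_div_iff (mul_ne_zero hn1 hn2)]
    linear_combination (-((n : ℚ) + 2)) * hA0 + (-((n : ℚ) + 1 - k)) * hA1
  have a3 : (((n + 2).choose (k + 1) : ℕ) : ℚ) = (((n + 2).choose k : ℕ) : ℚ) * (((n : ℚ) + 2 - k) / ((k : ℚ) + 1)) := by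
    rw [mul_div_assoc', eq_div_iff hk1]; linear_combination hA3
  have b1 : (((n + 1 + k).choose (n + 1) : ℕ) : ℚ) = (((n + k).choose n : ℕ) : ℚ) * (((n : ℚ) + k + 1) / ((n : ℚ) + 1)) := by
    rw [mul_div_assoc', eq_div_iff hn1]; linear_combination hB1
  have b2 : (((n + 2 + k).choose (n + 2) : ℕ) : ℚ) = (((n + k).choose n : ℕ) : ℚ) *
      ((((n : ℚ) + k + 1) * ((n : ℚ) + k + 2)) / (((n : ℚ) + 1) * ((n : ℚ) + 2))) := by
    rw [mul_div_assoc', eq_div_iff (mul_ne_zero hn1 hn2)]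
    linear_combination ((n : ℚ) + 1) * hB2 + ((n : ℚ) + k + 2) * hB1
  have b3 : (((n + (k + 1)).choose n : ℕ) : ℚ) = (((n + k).choose n : ℕ) : ℚ) * (((n : ℚ) + k + 1) / ((k : ℚ) + 1)) := by
    rw [mul_div_assoc', eq_div_iff hk1]; linear_combination hB3
  have d1 : (((2 * k).choose (n + 1) : ℕ) : ℚ) = (((2 * k).choose n : ℕ) : ℚ) * ((2 * (k : ℚ) - n) / ((n : ℚ) + 1)) := by
    rw [mul_div_assoc', eq_div_iff hn1]; linear_combination hD1
  have d2 : (((2 * k).choose (n + 2) : ℕ) : ℚ) = (((2 * k).choose n : ℕ) : ℚ) *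
      (((2 * (k : ℚ) - n) * (2 * (k : ℚ) - n - 1)) / (((n : ℚ) + 1) * ((n : ℚ) + 2))) := by
    rw [mul_div_assoc', eq_div_iff (mul_ne_zero hn1 hn2)]
    linear_combination ((n : ℚ) + 1) * hD2 + (2 * (k : ℚ) - n - 1) * hD1
  have d3 : (((2 * (k + 1)).choose (n + 2) : ℕ) : ℚ) = (((2 * k).choose n : ℕ) : ℚ) *
      (((2 * (k : ℚ) + 1) * (2 * (k : ℚ) + 2)) / (((n : ℚ) + 1) * ((n : ℚ) + 2))) := by
    rw [mul_div_assoc', eq_div_iff (mul_ne_zero hn1 hn2)]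
    linear_combination ((n : ℚ) + 1) * hE2 + (2 * (k : ℚ) + 2) * hE1
  unfold s7Term s7Cert
  rw [a0, a1, a3, b1, b2, b3, d1, d2, d3]
  push_cast
  field_simp
  ring

/-- **Cooper's recurrence for `s₇`** (all `n`):
`(n+2)³ s₇(n+2) = (2n+3)(13(n+1)²+13(n+1)+4) s₇(n+1) + 3(n+1)(9(n+1)²−1) s₇(n)`. -/
theorem cooperS7_rec (n : ℕ) :
    ((n : ℚ) + 2) ^ 3 * (cooperS7 (n + 2) : ℚ) =
      (2 * (n : ℚ) + 3) * (13 * ((n : ℚ) + 1) ^ 2 + 13 * ((n : ℚ) + 1) + 4) * (cooperS7 (n + 1) : ℚ)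
        + 3 * ((n : ℚ) + 1) * (9 * ((n : ℚ) + 1) ^ 2 - 1) * (cooperS7 n : ℚ) := by
  have ext : ∀ m j : ℕ, m ≤ j → ∑ k ∈ range (m + 1), s7Term m k = ∑ k ∈ range (j + 1), s7Term m k := by
    intro m j hmj
    apply sum_subset (range_subset_range.2 (by omega))
    intro k _ hk
    simp only [mem_range, not_lt] at hk
    simp [s7Term, Nat.choose_eq_zero_of_lt (by omega : m < k)]
  rw [cast_cooperS7, cast_cooperS7, cast_cooperS7, ext n (n + 2) (by omega), ext (n + 1) (n + 2) (by omega)]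
  have hsum : ∑ k ∈ range (n + 2 + 1), (-3 * ((n : ℚ) + 1) * (9 * ((n : ℚ) + 1) ^ 2 - 1) * s7Term n k
      - (2 * (n : ℚ) + 3) * (13 * ((n : ℚ) + 1) ^ 2 + 13 * ((n : ℚ) + 1) + 4) * s7Term (n + 1) k
      + ((n : ℚ) + 2) ^ 3 * s7Term (n + 2) k) = 0 := by
    rw [sum_congr rfl fun k _ => s7_termwise n k, sum_range_sub]
    have htop : s7Cert n (n + 2 + 1) = 0 := by
      simp [s7Cert]
    rw [htop]; simp [s7Cert]
  rw [sum_add_distrib, sum_sub_distrib, ← mul_sum, ← mul_sum, ← mul_sum] at hsum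
  linear_combination hsum

/-! ### Identification of the corner `ζ(5)`-coefficients -/

/-- **`cornerU_level7` IS A THEOREM**: `n!⁶ · U(n;0⁷) = 2(−1)^n s₇(n)` for every `n`. -/
theorem cornerU_level7_holds : cornerU_level7 := by
  -- both `A n = (-1)^n n!^6 U_n` and `B n = 2 s₇(n)` solve the level-7 recurrence with `A 0 = B 0`, `A 1 = B 1`
  have key : ∀ n, ((-1) ^ n * (n.factorial : ℚ) ^ 6 * coeffU (bCorner n) = 2 * (cooperS7 n : ℚ)) ∧
      ((-1) ^ (n + 1) * ((n + 1).factorial : ℚ) ^ 6 * coeffU (bCorner (n + 1)) = 2 * (cooperS7 (n + 1) : ℚ)) := by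
    intro n
    induction n with
    | zero =>
      refine ⟨?_, ?_⟩
      · rw [coeff_bCorner_zero.1, show cooperS7 0 = 1 by decide]; norm_num
      · rw [coeff_bCorner_one.1, show cooperS7 1 = 4 by decide]; norm_num
    | succ m ih =>
      refine ⟨ih.2, ?_⟩
      have hA := cornerU_recurrence (m + 1) (by omega)
      have hB := cooperS7_rec m
      rw [show m + 1 - 1 = m from rfl] at hA
      rw [show m + 1 + 1 = m + 2 from rfl]
      have h3 : ((m : ℚ) + 2) ^ 3 ≠ 0 := by positivity
      push_cast at hA hB ⊢
      have eA : (-1) ^ (m + 2) * ((m + 2).factorial : ℚ) ^ 6 * coeffU (bCorner (m + 2)) =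
          ((2 * (m : ℚ) + 3) * (13 * ((m : ℚ) + 1) ^ 2 + 13 * ((m : ℚ) + 1) + 4)
              * ((-1) ^ (m + 1) * ((m + 1).factorial : ℚ) ^ 6 * coeffU (bCorner (m + 1)))
            + 3 * ((m : ℚ) + 1) * (9 * ((m : ℚ) + 1) ^ 2 - 1) * ((-1) ^ m * (m.factorial : ℚ) ^ 6 * coeffU (bCorner m)))
            / ((m : ℚ) + 2) ^ 3 := by
        rw [eq_div_iff h3]; linear_combination hA
      rw [eA, ih.1, ih.2, div_eq_iff h3]
      linear_combination (-2 : ℚ) * hB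
  intro n
  have h := (key n).1
  have hs : ((-1 : ℚ) ^ n) * (-1) ^ n = 1 := by rw [← pow_add, ← two_mul, pow_mul]; norm_num
  calc (n.factorial : ℚ) ^ 6 * coeffU (bCorner n)
      = (-1) ^ n * ((-1) ^ n * (n.factorial : ℚ) ^ 6 * coeffU (bCorner n)) := by
        linear_combination (-(n.factorial : ℚ) ^ 6 * coeffU (bCorner n)) * hs
    _ = 2 * (-1) ^ n * (cooperS7 n : ℚ) := by rw [h]; ring

end Summit.KontsevichZagierPeriods.Zeta5Search.WedgeDictionary
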